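import Summits.AtomisticToContinuum.HydrodynamicLimit.Theorems.TwoClocksEquilibriumFastWindowLDBirthT12Legendre
import HarnessLib

/-!
# The second moments `∫ x² P_n²` of the Legendre polynomials, the sharper one-step bound
# `μ_n² ≤ (16/3) ∫₀¹ x² P_n²`, and the SIX-step certificate `Σ_{ℓ ≥ 2} c_ℓ μ_ℓ⁶ ≤ 1/2`
# (FF4 of plan §6 of `t12_logLinearPreimage_and_dipoleModulus`, line `birth`, crux
# `TwoClocks.EquilibriumFastWindowLD`, stmt-AtomisticToContinuum-14440; infrastructure file 5)

Companion of `…BirthT12LegendreCertificate` (the eight-step number `Σ c_ℓ μ_ℓ⁸ ≤ 2/3` from the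
crude tail bounds alone; notation `c_ℓ = (2ℓ+1)/2 · ‖P_ℓ‖_{L¹[-1,1]}`, `μ_ℓ = 4∫₀¹ ρ²|P_ℓ(ρ)| dρ`,
`P_ℓ = Literature.Analysis.SpecialFunctions.legendre ℓ`). Here the supporting identity and the
sharper six-step number:

* `integral_X_mul_legendre_succ_mul_legendre_val` — `∫_{-1}^{1} x P_{n+1} P_n = 2(n+1)/((2n+1)(2n+3))`
  (the tree's `(p_n/p_{n+1}) · 2/(2n+3)` with `p_{n+1} = (2n+1)/(n+1) · p_n`);
* **`t12_legendre_sqMoment`** (registered helper) —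
  `∫_{-1}^{1} x² P_n(x)² dx = 2(2n²+2n-1)/((2n-1)(2n+1)(2n+3))` for every `n` (Bonnet:
  `(2n+3) x P_{n+1} = (n+2)P_{n+2} + (n+1)P_n`, then the two mixed moments; `n = 0` directly),
  and its half-range form `integral_sq_mul_legendre_sq_half` (even integrand);
* `sq_four_mul_integral_sq_mul_abs_legendre_le` — the sharper Cauchy–Schwarz bound
  `μ_n² ≤ B_n := 16(2n²+2n-1)/(3(2n-1)(2n+1)(2n+3)) = (16/3) ∫₀¹ ρ² P_n²` (`ρ²|P| = ρ · ρ|P|`;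
  asymptotically `μ_n ≲ 4/√(6(2n+1))` against the crude `4/√(5(2n+1))` of `…BirthT12Legendre`);
* `cWeight_mul_mu_pow_six_le` — `c_n μ_n⁶ ≤ ((2n+1)+a²)/(2a) · B_n³` for every `a > 0`
  (`c_n ≤ √(2n+1)`, AM–GM), `cWeight_mul_mu_pow_six_two_le` — `c₂ μ₂⁶ ≤ 0.12735` from the exact
  `‖P₂‖₁ = 4√3/9`, `μ₂ = 8/15 + 8√3/135`; `legendreMajorantSix_step` — the telescoping of the
  tail `n ≥ 8` at `a = 6` against `φ(n) = (2/5)(1/n + 9/n²)` (a degree-11 polynomial inequality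
  with positive coefficients);
* **`farField_legendreCertificate_six`** — `Σ_{2 ≤ ℓ ≤ N+1} c_ℓ μ_ℓ⁶ ≤ 1/2` for every `N`
  (`ℓ = 2, 3` exact, `ℓ = 4..7` at `a = 10/3`, tail `φ(8)`: `0.1274 + 0.0486 + 0.1842 + 0.1063`),
  and `farField_legendreCertificate_six_tsum` (summable, sum `≤ 1/2`). Numerically `θ_6 = 0.26`.

So plan §6 may iterate SIX far-field steps with contraction ratio `≤ 1/2` (or eight with `≤ 2/3`).
NOT here: exact head values `ℓ ≥ 4` (roots of `P₄, P₅, …`), `k ≤ 5`.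
-/

noncomputable section

open MeasureTheory Real Set intervalIntegral Polynomial
namespace Summit.AtomisticToContinuum.HydrodynamicLimit.Theorems.ClampedCorrectorBirth
open Literature.Analysis.SpecialFunctions

/-! ### The mixed moment `∫ x P_{n+1} P_n` in closed form -/

/-- `∫_{-1}^{1} x P_{n+1}(x) P_n(x) dx = 2(n+1)/((2n+1)(2n+3))`. [folklore] -/
theorem integral_X_mul_legendre_succ_mul_legendre_val (n : ℕ) :
    ∫ x in (-1 : ℝ)..1, x * (legendre (n + 1)).eval x * (legendre n).eval x =
      2 * ((n : ℝ) + 1) / ((2 * n + 1) * (2 * n + 3)) := by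
  rw [integral_X_mul_legendre_succ_mul_legendre, legendreLead_succ]
  have hp : legendreLead n ≠ 0 := (legendreLead_pos n).ne'
  have h1 : (2 * (n : ℝ) + 1) ≠ 0 := by positivity
  have h2 : ((n : ℝ) + 1) ≠ 0 := by positivity
  push_cast
  field_simp
  ring

/-! ### The second moment `∫ x² P_n²` -/

/-- **`∫_{-1}^{1} x² P_n(x)² dx = 2(2n²+2n-1)/((2n-1)(2n+1)(2n+3))`** for the tree's Rodrigues
Legendre polynomials, all `n ≥ 0` (`n = 0`: `2/3`). From Bonnet's recursion
`(2n+3) x P_{n+1} = (n+2) P_{n+2} + (n+1) P_n`, `x² P_{n+1}² = x P_{n+1} · x P_{n+1}` and the two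
mixed moments `∫ x P_{m+1} P_m = 2(m+1)/((2m+1)(2m+3))`. The exact input of the Cauchy–Schwarz
head bounds of the far-field Legendre certificate (plan §6, FF4). Registered helper. -/
theorem t12_legendre_sqMoment : ∀ n : ℕ, ∫ x in (-1 : ℝ)..1, x ^ 2 * (Literature.Analysis.SpecialFunctions.legendre n).eval x ^ 2 = 2 * (2 * (n : ℝ) ^ 2 + 2 * n - 1) / ((2 * (n : ℝ) - 1) * (2 * n + 1) * (2 * n + 3)) := by
  intro n
  cases n with
  | zero =>
      simp only [legendre_zero, eval_one, one_pow, mul_one, Nat.cast_zero]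
      rw [integral_pow]
      norm_num
  | succ N =>
      -- Bonnet at the point `x`
      have hB : ∀ x : ℝ, ((N : ℝ) + 2) * (legendre (N + 2)).eval x =
          (2 * (N : ℝ) + 3) * x * (legendre (N + 1)).eval x - ((N : ℝ) + 1) * (legendre N).eval x := by
        intro x
        have h := congrArg (fun p : ℝ[X] => p.eval x) (legendre_succ_succ N)
        simpa only [eval_mul, eval_sub, eval_C, eval_X] using h
      have h3 : (2 * (N : ℝ) + 3) ≠ 0 := by positivity
      have hpt : ∀ x : ℝ, x ^ 2 * (legendre (N + 1)).eval x ^ 2 =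
          (((N : ℝ) + 2) * (x * (legendre (N + 2)).eval x * (legendre (N + 1)).eval x) +
            ((N : ℝ) + 1) * (x * (legendre (N + 1)).eval x * (legendre N).eval x)) /
            (2 * (N : ℝ) + 3) := by
        intro x
        rw [eq_div_iff h3]
        linear_combination (-(x * (legendre (N + 1)).eval x)) * hB x
      have hI1 : IntervalIntegrable (fun x : ℝ =>
          ((N : ℝ) + 2) * (x * (legendre (N + 2)).eval x * (legendre (N + 1)).eval x)) volume (-1) 1 :=
        (continuous_const.mul ((continuous_id.mul (legendre (N + 2)).continuous).mul
          (legendre (N + 1)).continuous)).intervalIntegrable _ _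
      have hI2 : IntervalIntegrable (fun x : ℝ =>
          ((N : ℝ) + 1) * (x * (legendre (N + 1)).eval x * (legendre N).eval x)) volume (-1) 1 :=
        (continuous_const.mul ((continuous_id.mul (legendre (N + 1)).continuous).mul
          (legendre N).continuous)).intervalIntegrable _ _
      have i1 := integral_X_mul_legendre_succ_mul_legendre_val (N + 1)
      have i0 := integral_X_mul_legendre_succ_mul_legendre_val N
      rw [show N + 1 + 1 = N + 2 from rfl] at i1
      simp_rw [hpt]
      rw [intervalIntegral.integral_div, intervalIntegral.integral_add hI1 hI2,
        intervalIntegral.integral_const_mul, intervalIntegral.integral_const_mul, i1, i0]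
      have h1 : (2 * (N : ℝ) + 1) ≠ 0 := by positivity
      have h5 : (2 * (N : ℝ) + 5) ≠ 0 := by positivity
      push_cast
      rw [show (2 * ((N : ℝ) + 1) - 1) = 2 * N + 1 by ring,
        show (2 * ((N : ℝ) + 1) + 3) = 2 * N + 5 by ring,
        show (2 * ((N : ℝ) + 1) + 1) = 2 * N + 3 by ring]
      field_simp
      ring

/-- Half-range form: `∫₀¹ x² P_n(x)² dx = (2n²+2n-1)/((2n-1)(2n+1)(2n+3))` (even integrand).
[folklore] -/
theorem integral_sq_mul_legendre_sq_half (n : ℕ) :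
    ∫ x in (0 : ℝ)..1, x ^ 2 * (legendre n).eval x ^ 2 =
      (2 * (n : ℝ) ^ 2 + 2 * n - 1) / ((2 * (n : ℝ) - 1) * (2 * n + 1) * (2 * n + 3)) := by
  have heven : ∀ x : ℝ, (-x) ^ 2 * (legendre n).eval (-x) ^ 2 = x ^ 2 * (legendre n).eval x ^ 2 := by
    intro x
    rw [eval_neg_legendre, mul_pow, ← pow_mul, mul_comm n 2, pow_mul, neg_one_sq, one_pow, one_mul,
      neg_sq]
  have hc : Continuous fun x : ℝ => x ^ 2 * (legendre n).eval x ^ 2 :=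
    (continuous_pow 2).mul ((legendre n).continuous.pow 2)
  have h := t12_legendre_sqMoment n
  rw [integral_symm_interval_of_even heven (fun a b => hc.intervalIntegrable a b)] at h
  linear_combination (1 / 2 : ℝ) * h

/-! ### The sharper one-step bound `μ_n² ≤ (16/3) ∫₀¹ x² P_n²` -/

/-- The closed form of `∫₀¹ x² P_n²` is positive (it is `1/3` at `n = 0`). [folklore] -/
theorem legendre_sqMoment_pos (n : ℕ) :
    0 < (2 * (n : ℝ) ^ 2 + 2 * n - 1) / ((2 * (n : ℝ) - 1) * (2 * n + 1) * (2 * n + 3)) := by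
  rcases Nat.eq_zero_or_pos n with rfl | hn
  · norm_num
  · have h1 : (1 : ℝ) ≤ n := by exact_mod_cast hn
    have ha : 0 < 2 * (n : ℝ) ^ 2 + 2 * n - 1 := by nlinarith
    have hb : 0 < 2 * (n : ℝ) - 1 := by linarith
    positivity

/-- **`μ_n² = (4 ∫₀¹ ρ² |P_n(ρ)| dρ)² ≤ 16(2n²+2n-1)/(3(2n-1)(2n+1)(2n+3)) = (16/3) ∫₀¹ ρ² P_n²`**
(Cauchy–Schwarz `ρ²|P| = ρ · ρ|P|` in the AM–GM form `ρ²|P| ≤ (t ρ² + ρ²P²/t)/2`,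
`t = √(3 ∫₀¹ρ²P_n²)`, `∫₀¹ ρ² = 1/3`): the sharper head/tail input of the far-field Legendre
certificates (asymptotically `μ_n ≲ 4/√(6(2n+1))`). [folklore] -/
theorem sq_four_mul_integral_sq_mul_abs_legendre_le (n : ℕ) :
    (4 * ∫ x in (0 : ℝ)..1, x ^ 2 * |(legendre n).eval x|) ^ 2 ≤
      16 * (2 * (n : ℝ) ^ 2 + 2 * n - 1) / (3 * ((2 * (n : ℝ) - 1) * (2 * n + 1) * (2 * n + 3))) := by
  set M : ℝ := (2 * (n : ℝ) ^ 2 + 2 * n - 1) / ((2 * (n : ℝ) - 1) * (2 * n + 1) * (2 * n + 3))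
    with hM
  have hM0 : 0 < M := legendre_sqMoment_pos n
  have hMi : ∫ x in (0 : ℝ)..1, x ^ 2 * (legendre n).eval x ^ 2 = M :=
    integral_sq_mul_legendre_sq_half n
  set t : ℝ := Real.sqrt (3 * M) with ht
  have ht0 : 0 < t := Real.sqrt_pos.2 (by positivity)
  have ht2 : t ^ 2 = 3 * M := Real.sq_sqrt (by positivity)
  -- pointwise AM–GM
  have hpt : ∀ x : ℝ, x ^ 2 * |(legendre n).eval x| ≤
      (t * x ^ 2 + x ^ 2 * (legendre n).eval x ^ 2 / t) / 2 := by
    intro x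
    have h := sq_nonneg (t * |x| - |x| * |(legendre n).eval x|)
    have hx2 : |x| ^ 2 = x ^ 2 := sq_abs x
    have hxx : x ^ 2 * |(legendre n).eval x| = |x| * (|x| * |(legendre n).eval x|) := by
      rw [← mul_assoc, ← sq, hx2]
    rw [hxx, le_div_iff₀ (by norm_num : (0 : ℝ) < 2)]
    have key : 2 * t * (|x| * (|x| * |(legendre n).eval x|)) ≤
        t ^ 2 * x ^ 2 + x ^ 2 * (legendre n).eval x ^ 2 := by
      have e : (t * |x| - |x| * |(legendre n).eval x|) ^ 2 =
          t ^ 2 * x ^ 2 + x ^ 2 * (legendre n).eval x ^ 2 -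
            2 * t * (|x| * (|x| * |(legendre n).eval x|)) := by
        rw [sub_sq, mul_pow, mul_pow, hx2, sq_abs]
        ring
      linarith [h, e]
    have e2 : (t * x ^ 2 + x ^ 2 * (legendre n).eval x ^ 2 / t) * t =
        t ^ 2 * x ^ 2 + x ^ 2 * (legendre n).eval x ^ 2 := by
      rw [add_mul, div_mul_cancel₀ _ ht0.ne']
      ring
    nlinarith [key, e2, ht0]
  have hJ : IntervalIntegrable (fun x : ℝ => x ^ 2 * |(legendre n).eval x|) volume 0 1 :=
    ((continuous_pow 2).mul (continuous_abs.comp (legendre n).continuous)).intervalIntegrable _ _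
  have hA : IntervalIntegrable (fun x : ℝ => t * x ^ 2) volume 0 1 :=
    ((continuous_pow 2).intervalIntegrable _ _).const_mul _
  have hB : IntervalIntegrable (fun x : ℝ => x ^ 2 * (legendre n).eval x ^ 2 / t) volume 0 1 :=
    (((continuous_pow 2).mul ((legendre n).continuous.pow 2)).intervalIntegrable _ _).div_const _
  have key : ∫ x in (0 : ℝ)..1, x ^ 2 * |(legendre n).eval x| ≤ t / 3 := by
    calc ∫ x in (0 : ℝ)..1, x ^ 2 * |(legendre n).eval x|
        ≤ ∫ x in (0 : ℝ)..1, (t * x ^ 2 + x ^ 2 * (legendre n).eval x ^ 2 / t) / 2 :=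
          integral_mono_on zero_le_one hJ ((hA.add hB).div_const _) fun x _ => hpt x
      _ = (t * (1 / 3) + M / t) / 2 := by
          rw [intervalIntegral.integral_div, integral_add hA hB, intervalIntegral.integral_const_mul,
            integral_pow, intervalIntegral.integral_div, hMi]
          norm_num
      _ = t / 3 := by
          field_simp
          nlinarith [ht2]
  have hI0 : 0 ≤ ∫ x in (0 : ℝ)..1, x ^ 2 * |(legendre n).eval x| :=
    intervalIntegral.integral_nonneg zero_le_one fun x _ => by positivity
  calc (4 * ∫ x in (0 : ℝ)..1, x ^ 2 * |(legendre n).eval x|) ^ 2 ≤ (4 * (t / 3)) ^ 2 := by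
        gcongr
    _ = 16 * M / 3 := by rw [mul_pow, div_pow, ht2]; ring
    _ = _ := by rw [hM]; field_simp


/-! ### The six-step certificate `Σ_{ℓ ≥ 2} c_ℓ μ_ℓ⁶ ≤ 1/2` -/

/-- `0 ≤ c_n μ_n⁶`. [folklore] -/
theorem cWeight_mul_mu_pow_six_nonneg (n : ℕ) :
    0 ≤ (2 * (n : ℝ) + 1) / 2 * (∫ x in (-1 : ℝ)..1, |(legendre n).eval x|) *
      (4 * ∫ ρ in (0 : ℝ)..1, ρ ^ 2 * |(legendre n).eval ρ|) ^ 6 :=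
  mul_nonneg (mul_nonneg (by positivity)
    (intervalIntegral.integral_nonneg (by norm_num) fun x _ => abs_nonneg _))
    (pow_nonneg (mul_nonneg (by norm_num)
      (intervalIntegral.integral_nonneg zero_le_one fun ρ _ => by positivity)) 6)

/-- **One term of the six-step series, `c_n μ_n⁶ ≤ ((2n+1) + a²)/(2a) · B_n³`** for every `n` and
every `a > 0`, with `B_n := 16(2n²+2n-1)/(3(2n-1)(2n+1)(2n+3)) ≥ μ_n²`
(`sq_four_mul_integral_sq_mul_abs_legendre_le`) and `c_n ≤ √(2n+1) ≤ ((2n+1) + a²)/(2a)`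
(`‖P_n‖₁ ≤ 2/√(2n+1)`, AM–GM). [folklore] -/
theorem cWeight_mul_mu_pow_six_le (n : ℕ) {a : ℝ} (ha : 0 < a) :
    (2 * (n : ℝ) + 1) / 2 * (∫ x in (-1 : ℝ)..1, |(legendre n).eval x|) *
        (4 * ∫ ρ in (0 : ℝ)..1, ρ ^ 2 * |(legendre n).eval ρ|) ^ 6 ≤
      ((2 * (n : ℝ) + 1) + a ^ 2) / (2 * a) *
        (16 * (2 * (n : ℝ) ^ 2 + 2 * n - 1) / (3 * ((2 * (n : ℝ) - 1) * (2 * n + 1) * (2 * n + 3)))) ^ 3 := by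
  have hB := sq_four_mul_integral_sq_mul_abs_legendre_le n
  set B : ℝ := 16 * (2 * (n : ℝ) ^ 2 + 2 * n - 1) / (3 * ((2 * (n : ℝ) - 1) * (2 * n + 1) * (2 * n + 3)))
    with hBdef
  set m : ℝ := 2 * n + 1 with hm
  set I : ℝ := ∫ x in (-1 : ℝ)..1, |(legendre n).eval x| with hI
  set μ : ℝ := 4 * ∫ ρ in (0 : ℝ)..1, ρ ^ 2 * |(legendre n).eval ρ| with hμ
  have hm0 : 0 < m := by positivity
  have h1 : I ≤ 2 / Real.sqrt m := integral_abs_legendre_le n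
  have h3 : μ ^ 6 ≤ B ^ 3 := by
    calc μ ^ 6 = (μ ^ 2) ^ 3 := by ring
      _ ≤ B ^ 3 := pow_le_pow_left₀ (sq_nonneg μ) hB 3
  have h4 : m / 2 * I ≤ (m + a ^ 2) / (2 * a) := by
    calc m / 2 * I ≤ m / 2 * (2 / Real.sqrt m) := by gcongr
      _ = m / Real.sqrt m := by ring
      _ = Real.sqrt m := Real.div_sqrt
      _ ≤ (m + a ^ 2) / (2 * a) := by
          rw [le_div_iff₀ (by positivity)]
          nlinarith [sq_nonneg (Real.sqrt m - a), Real.sq_sqrt hm0.le]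
  exact mul_le_mul h4 h3 (by positivity) (by positivity)

/-- The `ℓ = 2` term exactly: `c₂ μ₂⁶ = (10√3/9)(8/15 + 8√3/135)⁶ ≤ 2547/20000` (`= 0.12734…`,
from `‖P₂‖₁ = 4√3/9`, `μ₂ = 8/15 + 8√3/135` and `√3 ≤ 1.7321`). [folklore] -/
theorem cWeight_mul_mu_pow_six_two_le :
    (2 * ((2 : ℕ) : ℝ) + 1) / 2 * (∫ x in (-1 : ℝ)..1, |(legendre 2).eval x|) *
        (4 * ∫ ρ in (0 : ℝ)..1, ρ ^ 2 * |(legendre 2).eval ρ|) ^ 6 ≤ 2547 / 20000 := by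
  rw [integral_abs_legendre_two, t12_legendre_mu_two]
  have hs : Real.sqrt 3 ≤ 17321 / 10000 := by
    calc Real.sqrt 3 ≤ Real.sqrt ((17321 / 10000) ^ 2) := Real.sqrt_le_sqrt (by norm_num)
      _ = 17321 / 10000 := Real.sqrt_sq (by norm_num)
  have hs0 : 0 ≤ Real.sqrt 3 := Real.sqrt_nonneg 3
  calc (2 * ((2 : ℕ) : ℝ) + 1) / 2 * (4 * Real.sqrt 3 / 9) * (8 / 15 + 8 * Real.sqrt 3 / 135) ^ 6
      ≤ (2 * ((2 : ℕ) : ℝ) + 1) / 2 * (4 * (17321 / 10000) / 9) *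
          (8 / 15 + 8 * (17321 / 10000) / 135) ^ 6 := by gcongr
    _ ≤ 2547 / 20000 := by norm_num

/-- Telescoping step of the six-step tail: for `n = k + 8 ≥ 8`,
`((2n+1) + 36)/12 · B_n³ ≤ φ(n) - φ(n+1)` with `φ(n) = (2/5)(1/n + 9/n²)` — after clearing
denominators, a degree-11 polynomial inequality in `k` with positive coefficients. [folklore] -/
theorem legendreMajorantSix_step (k : ℕ) :
    ((2 * ((k : ℝ) + 8) + 1) + 6 ^ 2) / (2 * 6) *
        (16 * (2 * ((k : ℝ) + 8) ^ 2 + 2 * ((k : ℝ) + 8) - 1) /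
          (3 * ((2 * ((k : ℝ) + 8) - 1) * (2 * ((k : ℝ) + 8) + 1) * (2 * ((k : ℝ) + 8) + 3)))) ^ 3 ≤
      2 / 5 * (1 / ((k : ℝ) + 8) + 9 / ((k : ℝ) + 8) ^ 2) -
        2 / 5 * (1 / ((k : ℝ) + 8 + 1) + 9 / ((k : ℝ) + 8 + 1) ^ 2) := by
  rw [← sub_nonneg]
  have hk : (0 : ℝ) ≤ k := Nat.cast_nonneg k
  have d1 : (2 * ((k : ℝ) + 8) - 1) ≠ 0 := by nlinarith
  have e : 2 / 5 * (1 / ((k : ℝ) + 8) + 9 / ((k : ℝ) + 8) ^ 2) -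
        2 / 5 * (1 / ((k : ℝ) + 8 + 1) + 9 / ((k : ℝ) + 8 + 1) ^ 2) -
      ((2 * ((k : ℝ) + 8) + 1) + 6 ^ 2) / (2 * 6) *
        (16 * (2 * ((k : ℝ) + 8) ^ 2 + 2 * ((k : ℝ) + 8) - 1) /
          (3 * ((2 * ((k : ℝ) + 8) - 1) * (2 * ((k : ℝ) + 8) + 1) * (2 * ((k : ℝ) + 8) + 3)))) ^ 3 =
      (127793074346280 +
          173591134950600 * (k : ℝ) +
          104589184950040 * (k : ℝ) ^ 2 +
          37019790190160 * (k : ℝ) ^ 3 +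
          8570032417280 * (k : ℝ) ^ 4 +
          1363750925568 * (k : ℝ) ^ 5 +
          152236055296 * (k : ℝ) ^ 6 +
          11913458176 * (k : ℝ) ^ 7 +
          639510528 * (k : ℝ) ^ 8 +
          22366208 * (k : ℝ) ^ 9 +
          456704 * (k : ℝ) ^ 10 +
          4096 * (k : ℝ) ^ 11) /
        (1620 * ((k : ℝ) + 8) ^ 2 * ((k : ℝ) + 8 + 1) ^ 2 *
          ((2 * ((k : ℝ) + 8) - 1) * (2 * ((k : ℝ) + 8) + 1) * (2 * ((k : ℝ) + 8) + 3)) ^ 3) := by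
    field_simp
    ring
  rw [e]
  have d2 : 0 < (2 * ((k : ℝ) + 8) - 1) := by nlinarith
  positivity


/-- **FF4 for six steps: `Σ_{2 ≤ ℓ ≤ N+1} c_ℓ μ_ℓ⁶ ≤ 1/2 < 1` for every `N`** (index shifted to
`ℓ + 2`). Head: `ℓ = 2` exactly (`cWeight_mul_mu_pow_six_two_le`, `0.1274`), `ℓ = 3` exactly
(`‖P₃‖₁ = 13/20`, `μ₃ = 79/150`: `0.0486`), `ℓ = 4, …, 7` by `cWeight_mul_mu_pow_six_le` at
`a = 10/3` (`0.0816 + 0.0485 + 0.0318 + 0.0224`); tail `ℓ ≥ 8` at `a = 6`, telescoped by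
`legendreMajorantSix_step` into `φ(8) = (2/5)(1/8 + 9/64) = 0.10625`; total `0.4663 ≤ 1/2`
(numerically `θ_6 = 0.26`). [folklore] -/
theorem farField_legendreCertificate_six : ∀ N : ℕ, ∑ ℓ ∈ Finset.range N,
    (2 * ((ℓ + 2 : ℕ) : ℝ) + 1) / 2 * (∫ x in (-1 : ℝ)..1, |(legendre (ℓ + 2)).eval x|) *
      (4 * ∫ ρ in (0 : ℝ)..1, ρ ^ 2 * |(legendre (ℓ + 2)).eval ρ|) ^ 6 ≤ 1 / 2 := by
  -- for `M ≥ 6`: partial sum `≤ 1/2 - φ(M+2)`, `φ(n) = (2/5)(1/n + 9/n²)`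
  have key : ∀ M : ℕ, 6 ≤ M → ∑ ℓ ∈ Finset.range M,
      (2 * ((ℓ + 2 : ℕ) : ℝ) + 1) / 2 * (∫ x in (-1 : ℝ)..1, |(legendre (ℓ + 2)).eval x|) *
        (4 * ∫ ρ in (0 : ℝ)..1, ρ ^ 2 * |(legendre (ℓ + 2)).eval ρ|) ^ 6 ≤
        1 / 2 - 2 / 5 * (1 / ((M : ℝ) + 2) + 9 / ((M : ℝ) + 2) ^ 2) := by
    intro M hM
    induction M, hM using Nat.le_induction with
    | base =>
        rw [Finset.sum_range_succ, Finset.sum_range_succ, Finset.sum_range_succ,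
          Finset.sum_range_succ, Finset.sum_range_succ, Finset.sum_range_succ,
          Finset.sum_range_zero,
          show (0 + 2 : ℕ) = 2 from rfl, show (1 + 2 : ℕ) = 3 from rfl,
          show (2 + 2 : ℕ) = 4 from rfl, show (3 + 2 : ℕ) = 5 from rfl,
          show (4 + 2 : ℕ) = 6 from rfl, show (5 + 2 : ℕ) = 7 from rfl]
        have h2 := cWeight_mul_mu_pow_six_two_le
        have h3 : (2 * ((3 : ℕ) : ℝ) + 1) / 2 * (∫ x in (-1 : ℝ)..1, |(legendre 3).eval x|) *
            (4 * ∫ ρ in (0 : ℝ)..1, ρ ^ 2 * |(legendre 3).eval ρ|) ^ 6 ≤ 4856 / 100000 := by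
          rw [integral_abs_legendre_three, four_mul_integral_sq_mul_abs_legendre_three]
          norm_num
        have h4 := (cWeight_mul_mu_pow_six_le 4 (a := 10 / 3) (by norm_num)).trans
          (show _ ≤ (8157 / 100000 : ℝ) by norm_num)
        have h5 := (cWeight_mul_mu_pow_six_le 5 (a := 10 / 3) (by norm_num)).trans
          (show _ ≤ (4848 / 100000 : ℝ) by norm_num)
        have h6 := (cWeight_mul_mu_pow_six_le 6 (a := 10 / 3) (by norm_num)).trans
          (show _ ≤ (3179 / 100000 : ℝ) by norm_num)
        have h7 := (cWeight_mul_mu_pow_six_le 7 (a := 10 / 3) (by norm_num)).trans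
          (show _ ≤ (2231 / 100000 : ℝ) by norm_num)
        have hnum : (2547 / 20000 + 4856 / 100000 + 8157 / 100000 + 4848 / 100000 + 3179 / 100000 +
            2231 / 100000 : ℝ) ≤ 1 / 2 - 2 / 5 * (1 / (((6 : ℕ) : ℝ) + 2) + 9 / (((6 : ℕ) : ℝ) + 2) ^ 2) := by
          norm_num
        linarith
    | succ M hM ih =>
        rw [Finset.sum_range_succ]
        obtain ⟨k, rfl⟩ : ∃ k, M = k + 6 := ⟨M - 6, by omega⟩
        have hT := cWeight_mul_mu_pow_six_le (k + 6 + 2) (a := 6) (by norm_num)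
        have hS := legendreMajorantSix_step k
        have e1 : ((k + 6 + 2 : ℕ) : ℝ) = (k : ℝ) + 8 := by push_cast; ring
        have e3 : ((k + 6 : ℕ) : ℝ) + 2 = (k : ℝ) + 8 := by push_cast; ring
        have e4 : ((k + 6 + 1 : ℕ) : ℝ) + 2 = (k : ℝ) + 8 + 1 := by push_cast; ring
        rw [e1] at hT ⊢
        rw [e3] at ih
        rw [e4]
        linarith
  have hT : ∀ ℓ : ℕ, 0 ≤ (2 * ((ℓ + 2 : ℕ) : ℝ) + 1) / 2 *
      (∫ x in (-1 : ℝ)..1, |(legendre (ℓ + 2)).eval x|) *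
      (4 * ∫ ρ in (0 : ℝ)..1, ρ ^ 2 * |(legendre (ℓ + 2)).eval ρ|) ^ 6 :=
    fun ℓ => cWeight_mul_mu_pow_six_nonneg (ℓ + 2)
  intro N
  rcases le_or_gt 6 N with hN | hN
  · have h := key N hN
    have : (0 : ℝ) ≤ 2 / 5 * (1 / ((N : ℝ) + 2) + 9 / ((N : ℝ) + 2) ^ 2) := by positivity
    linarith
  · calc ∑ ℓ ∈ Finset.range N, (2 * ((ℓ + 2 : ℕ) : ℝ) + 1) / 2 *
            (∫ x in (-1 : ℝ)..1, |(legendre (ℓ + 2)).eval x|) *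
            (4 * ∫ ρ in (0 : ℝ)..1, ρ ^ 2 * |(legendre (ℓ + 2)).eval ρ|) ^ 6
        ≤ ∑ ℓ ∈ Finset.range 6, (2 * ((ℓ + 2 : ℕ) : ℝ) + 1) / 2 *
            (∫ x in (-1 : ℝ)..1, |(legendre (ℓ + 2)).eval x|) *
            (4 * ∫ ρ in (0 : ℝ)..1, ρ ^ 2 * |(legendre (ℓ + 2)).eval ρ|) ^ 6 :=
          Finset.sum_le_sum_of_subset_of_nonneg (Finset.range_mono hN.le) fun ℓ _ _ => hT ℓ
      _ ≤ 1 / 2 - 2 / 5 * (1 / (((6 : ℕ) : ℝ) + 2) + 9 / (((6 : ℕ) : ℝ) + 2) ^ 2) := key 6 le_rfl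
      _ ≤ 1 / 2 := by norm_num

/-- The series form for six steps: `ℓ ↦ c_{ℓ+2} μ_{ℓ+2}⁶` is summable and `Σ_{ℓ ≥ 2} c_ℓ μ_ℓ⁶ ≤ 1/2`.
[folklore] -/
theorem farField_legendreCertificate_six_tsum :
    Summable (fun ℓ : ℕ => (2 * ((ℓ + 2 : ℕ) : ℝ) + 1) / 2 *
        (∫ x in (-1 : ℝ)..1, |(legendre (ℓ + 2)).eval x|) *
        (4 * ∫ ρ in (0 : ℝ)..1, ρ ^ 2 * |(legendre (ℓ + 2)).eval ρ|) ^ 6) ∧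
      ∑' ℓ : ℕ, (2 * ((ℓ + 2 : ℕ) : ℝ) + 1) / 2 *
        (∫ x in (-1 : ℝ)..1, |(legendre (ℓ + 2)).eval x|) *
        (4 * ∫ ρ in (0 : ℝ)..1, ρ ^ 2 * |(legendre (ℓ + 2)).eval ρ|) ^ 6 ≤ 1 / 2 :=
  ⟨summable_of_sum_range_le (fun ℓ => cWeight_mul_mu_pow_six_nonneg (ℓ + 2))
      farField_legendreCertificate_six,
    tsum_le_of_sum_range_le (fun ℓ => cWeight_mul_mu_pow_six_nonneg (ℓ + 2))
      farField_legendreCertificate_six⟩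

end Summit.AtomisticToContinuum.HydrodynamicLimit.Theorems.ClampedCorrectorBirth
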